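import Mathlib
import Summits.Ventures.HodgeRepro.LitRank
import Summits.Ventures.HodgeRepro.KubotaChar

/-!
# Kubota's character formula in the printed vocabulary (`LitRank.lean`): the named fact is discharged

Blind re-derivation cell `pub-hodge-repro`, seat `typer-2`.  Built on seat lit-2's `LitRank.lean`
(Yanai's CM triples `(G, H, S̃)`, Kubota's rank `dim_ℚ (ℚ[G] · τ)`) and `KubotaChar.lean`.

* `CMTriple.rank_eq_cmRank` — Kubota's rank `T.rank = dim_ℚ range (x ↦ x τ)` (Kubota 1965 Lemma 1, as typed
  by lit-2) equals the type-matrix rank `cmRank T.S` of `CMRank.lean`, for EVERY triple (no hypothesis on `H`);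
* `CMTriple.isComplexConj_ρ`, `CMTriple.isCMType_ρ_S` — a triple is a CM type in the sense of `CMType.lean`;
* `charEquivHomUnits` — characters `AddChar (Additive G) ℂ` versus homomorphisms `G →* ℂˣ`;
* `Kubota_rank_abelian_charFormula_holds` — the printed fact `Kubota_rank_abelian_charFormula` of
  `LitRank.lean` (Kubota 1965 Lemma 2 in Mai's form) is TRUE: `T.rank = 1 + #{χ : G →* ℂˣ | χ(ρ) = −1 ∧ ∑_S χ ≠ 0}`
  for `G` finite abelian and `H = 1`.
-/

open Finset Matrix MonoidAlgebra
open scoped Pointwise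

namespace HodgeRepro.Lit2.CMTriple

variable {G : Type*} [Group G] [Fintype G] [DecidableEq G] (T : CMTriple G)

omit [Fintype G] [DecidableEq G] in
/-- Kubota's element `τ` (lit-2) is `qTypeOf S` (`MTLattice.lean`). -/
theorem tau_eq_qTypeOf : T.tau = Hecke.qTypeOf T.S := rfl

omit [DecidableEq G] in
/-- Right multiplication by `τ` on `ℚ[G]`, transported to `G → ℚ` through the coefficient map, is
multiplication by the matrix `rightMulMatrix τ`. -/
theorem coeffFun_comp_mulRight :
    (Hecke.coeffFun : MonoidAlgebra ℚ G ≃ₗ[ℚ] (G → ℚ)).toLinearMap ∘ₗ LinearMap.mulRight ℚ T.tau ∘ₗ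
      (Hecke.coeffFun : MonoidAlgebra ℚ G ≃ₗ[ℚ] (G → ℚ)).symm.toLinearMap =
      (Hecke.rightMulMatrix T.tau).mulVecLin := by
  apply LinearMap.ext
  intro v
  funext k
  simp only [LinearMap.comp_apply, LinearEquiv.coe_coe, LinearMap.mulRight_apply, Hecke.coeffFun_apply,
    Matrix.mulVecLin_apply, Matrix.mulVec, dotProduct, Hecke.rightMulMatrix_apply]
  rw [coeff_mul_apply_left, Finsupp.sum_fintype _ _ fun _ => zero_mul _]
  refine Finset.sum_congr rfl fun h _ => ?_
  rw [mul_comm]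
  congr 1

/-- **Kubota's rank is the type-matrix rank**: `T.rank = cmRank T.S` for every CM triple. -/
theorem rank_eq_cmRank : T.rank = cmRank T.S := by
  unfold rank
  have h1 : LinearMap.range ((Hecke.coeffFun : MonoidAlgebra ℚ G ≃ₗ[ℚ] (G → ℚ)).toLinearMap ∘ₗ
      LinearMap.mulRight ℚ T.tau ∘ₗ
      (Hecke.coeffFun : MonoidAlgebra ℚ G ≃ₗ[ℚ] (G → ℚ)).symm.toLinearMap) =
      (LinearMap.range (LinearMap.mulRight ℚ T.tau)).map
        (Hecke.coeffFun : MonoidAlgebra ℚ G ≃ₗ[ℚ] (G → ℚ)).toLinearMap := by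
    rw [LinearMap.range_comp, LinearMap.range_comp_of_range_eq_top]
    exact LinearEquiv.range _
  have h2 := LinearEquiv.finrank_map_eq (Hecke.coeffFun : MonoidAlgebra ℚ G ≃ₗ[ℚ] (G → ℚ))
    (LinearMap.range (LinearMap.mulRight ℚ T.tau))
  rw [← h2, ← h1, coeffFun_comp_mulRight]
  change (Hecke.rightMulMatrix T.tau).rank = cmRank T.S
  rw [Hecke.rank_rightMulMatrix, tau_eq_qTypeOf, Hecke.cmRank_eq_rank_leftMulMatrix]

omit [Fintype G] [DecidableEq G] in
/-- The conjugation `ρ` of a CM triple is a central involution in the sense of `CMType.lean`. -/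
theorem isComplexConj_ρ : IsComplexConj T.ρ where
  ne_one := T.ρ_ne_one
  mul_self := T.ρ_mul_self
  comm := T.ρ_comm

omit [Fintype G] [DecidableEq G] in
/-- The set `S̃` of a CM triple is a CM type in the sense of `CMType.lean` (with `ρ` central, the printed
right-hand condition `g ρ ∉ S̃` is the left-hand one). -/
theorem isCMType_ρ_S : IsCMType T.ρ T.S := by
  intro g
  rw [T.mem_iff g, T.ρ_comm g]

end HodgeRepro.Lit2.CMTriple

namespace HodgeRepro.Hecke

variable {G : Type*} [CommGroup G]

/-- Characters `AddChar (Additive G) ℂ` of a finite abelian group correspond to homomorphisms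
`G →* ℂˣ`. -/
def charEquivHomUnits : AddChar (Additive G) ℂ ≃ (G →* ℂˣ) where
  toFun ψ := MonoidHom.toHomUnits
    { toFun := fun g => ψ (Additive.ofMul g)
      map_one' := by simp
      map_mul' := fun g h => by simp [ofMul_mul, AddChar.map_add_eq_mul] }
  invFun χ :=
    { toFun := fun a => (χ (Additive.toMul a) : ℂ)
      map_zero_eq_one' := by simp
      map_add_eq_mul' := fun a b => by simp [toMul_add] }
  left_inv ψ := by
    ext a
    simp
  right_inv χ := by
    ext g
    simp

/-- The homomorphism attached to `ψ` takes the values of `ψ`. -/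
@[simp] theorem coe_charEquivHomUnits_apply (ψ : AddChar (Additive G) ℂ) (g : G) :
    ((charEquivHomUnits ψ) g : ℂ) = chiFun ψ g := rfl

variable [Fintype G] [DecidableEq G]

omit [DecidableEq G] in
open scoped Classical in
/-- The character count of `KubotaChar.lean`, transported to `G →* ℂˣ` (`Nat.card`). -/
theorem natCard_homUnits_eq {c : G} (S : Finset G) :
    Nat.card {χ : G →* ℂˣ // χ c = -1 ∧ (∑ s ∈ S, (χ s : ℂ)) ≠ 0} =
      Fintype.card {ψ : AddChar (Additive G) ℂ // chiFun ψ c = -1 ∧ charSum S ψ ≠ 0} := by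
  rw [← Nat.card_eq_fintype_card]
  refine Nat.card_congr (Equiv.subtypeEquiv (charEquivHomUnits (G := G)).symm fun χ => ?_)
  have hχ : ∀ g, chiFun ((charEquivHomUnits (G := G)).symm χ) g = (χ g : ℂ) := fun g => rfl
  simp only [charSum, hχ]
  constructor
  · rintro ⟨h1, h2⟩
    refine ⟨?_, h2⟩
    rw [h1]
    rfl
  · rintro ⟨h1, h2⟩
    refine ⟨?_, h2⟩
    exact Units.ext h1

end HodgeRepro.Hecke

namespace HodgeRepro.Lit2

/-- **The printed fact holds**: Kubota 1965, Lemma 2, in Mai's form (`Kubota_rank_abelian_charFormula`). -/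
theorem Kubota_rank_abelian_charFormula_holds : Kubota_rank_abelian_charFormula := by
  intro G _ _ _ T _
  rw [T.rank_eq_cmRank, Hecke.cmRank_eq_one_add_card_odd T.isComplexConj_ρ T.isCMType_ρ_S,
    Hecke.natCard_homUnits_eq]

end HodgeRepro.Lit2
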